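import Summits.QuantumFields.BalabanUV.T4Continuum.Support.ShellMeasureRootCompositionSeam

/-!
# `T4Continuum.ShellMeasureRootCompositionSeamTower` — NE7c ROOT COMPOSITION, THE SEAM END-I ∘ END-II ALONG THE
# CUTOFF-INDEXED LATTICE FAMILY: END-I for realized slot measures `(fieldMeasure (P K s) (j K s) G).withDensity F`
# on a Bałaban lattice chosen PER COMPARISON `K` AND PER SLOT (any compact gauge group `G`), the one-`Params` form of
# row S13 recovered as the constant special case — kernel bookkeeping, no estimate
# (cell `pub-balaban`, sub-cell `t4`, spine estimate NE7c (node U5b); NE7c ROUND-2 crew seat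
# `b2b-balaban-t4-ne7c-formalise-leaf-09` (gen 2), FINDING F-ne7cleaf09-2 + OFFERED row of the claim table
# `t4/b2b-balaban-t4-ne7c-p1/LEAVES-NE7c-P1.md` (the owner t4-ne7c-p1 books ∕ renumbers ∕ refuses); ADDITIVE — imports
# row S13's `ShellMeasureRootCompositionSeam` (p208381; hence END-I `ShellMeasureRootComposition` p207618) only and
# modifies nothing; 0 `def`, 0 sorry, 0 citations)

HONEST FRAMING.  Finite four-torus programme, rung (B)+1 only — NOT infinite volume, NOT a mass gap, NOT the Clay
problem, NOT summit progress; (B), `BetaPertHyp`, (B^μ) are not consumed.  NE7c = `T4IndicatorShell.ShellWeightBound`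
is NOT PRINTED in [Balaban 1983–89] and NOT PROVED; (M1) for Bałaban's inductively defined effective measures is NOT
PRINTED (GAPS G-ne7cp1-1), asserted by nobody and NOT moved here; every result below reads «NE7c ⇐ the named binders»
(trigger c3).  HONEST DEPENDENCY (cell): continuum YM on T⁴ ⇐ BetaPertH ∧ nine spine estimates (0/9 proved);
BetaPertH ⇐ (D1) ∧ (D4) ∧ CAP+tail; G-an2-4 gates asym, D1 and NE2/3/4.

THE FINDING (F-ne7cleaf09-2, type-level, on OUR composition; END-I∕END-II are correct theorems and untouched).  Row
S13's realized END-I `ShellMeasureRootCompositionSeam.shellWeightBound_of_levelDataSU2` (and `levelLedger_…`, `_band`,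
`hybridNE7_tail_…`, `hac_of_levelData`) types the slot measures of BOTH runs and of EVERY comparison index `K : ℕ` as
`(fieldMeasure P (lvl K s) SU2).withDensity (F K t s)` for ONE `P : Params`.  But `Params.K` IS the cutoff (`Setup`:
`ε = L^{-K}`, `sitesPerDir j = 2·L^{m+K−j}` with truncated subtraction), the index `K` of `ShellWeightBound` is «the
number of steps» of the comparison (`T4IndicatorShell` §4), the cell's scheme carries one lattice per cutoff
(`Missing.TorusScheme.P : ℕ → Params`), and node U1b's convention reads run B at comparison `K` as the `(K+1)`-step
run with its slot born one step later (`T4SupCloseLiaison.ReadsLevels`).  KERNEL WITNESS (§0): with one `P`, every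
level `j ≥ P.m + P.K` is the torus with `2` sites per direction, so under END-I's live window `K ≤ lvl K s + N₁` EVERY
live slot of EVERY comparison `K ≥ P.m + P.K + N₁` is typed on that degenerate torus (`sitesPerDir_live_eq_two`) — one
`Params` hosts the live levels of finitely many cutoffs only, whereas along a cutoff-indexed family the live level `j ≤ K`
keeps `2·L^{m+(K−j)} ≥ 2·L^m` sites per direction (`sitesPerDir_scheme`).  Nothing in S13 is false; its realized family
is a special case that the cell's objects inhabit for at most finitely many `K`.

THE REPAIR (this file; END-I is abstract in the slot spaces `Ω K s`, so the proofs are S13's, pointwise).  The realized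
slot measure of slot `s` of comparison `K` lives on ITS OWN Bałaban lattice `(P K s, j K s)` — `P : ℕ → σ → Params`,
`j : ℕ → σ → ℕ` free, DECOUPLED from END-I's level `lvl K s` (which indexes thresholds, widths, constants and the live
window) — over ANY gauge group `G` with Haar data (so the `SU(N)` road S3 needs no separate END-I):
* §1 `levelLedger_of_towerData` — one run; §2 `shellWeightBound_of_towerData`, `…_band` (road P2's head, c6),
  `hybridNE7_tail_of_towerData` (seam (ζ′) socket) — two runs; conclusions LITERALLY END-I's
  (`T4IndicatorShell.ShellWeightBound l₀ T A B shA shB Wsh`, same `Wsh`), the `IsFiniteMeasure` instances discharged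
  inside from `∫⁻ F ∂fieldMeasure ≠ ∞` per slot (S13's seam fact (i)), the slot→level majorants displayed (fact (ii)).
* §3 ONE READING of the two-run tower along a cutoff scheme `Psch : ℕ → Params` (`shellWeightBound_of_schemeData`:
  run A's slot of level `j` on `(Psch K, j)`, run B's on `(Psch (K+1), j+1)` — node U1b's `ReadsLevels` convention; a
  SPECIAL CASE offered to the [dict] seat, NOT a definition of NODE O).  Row S13's one-lattice `SU(2)` forms are the
  constant special case `P K s := P`, `j := lvl`, `G := SU2` of §1∕§2 (one-line instantiations; nothing landed is lost).
WHAT THIS DOES NOT DO.  No estimate binder is discharged (SM-L1…L8 displayed); the [dict] identification of the cell's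
term data with these slot families (NODE O) is constructed by nobody; (M1), NE7c NOT proved; spine 0/9.
-/

noncomputable section

open Finset MeasureTheory
open scoped ENNReal

namespace Summit.QuantumFields.BalabanUV.T4Continuum.ShellMeasureRootCompositionSeamTower

open Literature.MathematicalPhysics.QuantumFieldTheory.Balaban1983to89
open T4WeightBudget T4IndicatorShell T4MatchingAssembly T4MatchingClosure T4MatchingClosureSocket
open T4ShellMeasure (SlotAntiConcentration)
open T4ShellMeasureLevels (LevelLedger LiveWindow)
open ShellMeasureRootComposition (levelLedger_of_slotAC shellWeightBound_of_slotAC shellWeightBound_of_slotAC_band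
  hybridNE7_tail_of_slotAC)
open ShellMeasureRootCompositionSeam (hac_of_slotConst)

/-! ## §0 Kernel witness: ONE `Params` cannot carry the cutoff family -/

section Witness

/-- With ONE `P : Params` the lattice `T^{(j)}` has `2·L^{m+K−j}` sites per direction with TRUNCATED subtraction: every
level `j ≥ P.m + P.K` is typed on the torus with `2` sites per direction. [folklore] -/
theorem sitesPerDir_eq_two_of_le (P : Params) {j : ℕ} (hj : P.m + P.K ≤ j) : P.sitesPerDir j = 2 := by
  unfold Params.sitesPerDir
  rw [Nat.sub_eq_zero_of_le hj, pow_zero, mul_one]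

/-- **THE WITNESS.**  In a slot family typed on ONE `P : Params` whose levels obey END-I's live window
(`T4ShellMeasureLevels.LiveWindow.recent : K ≤ lvl K s + N₁`), EVERY live slot of EVERY comparison
`K ≥ P.m + P.K + N₁` sits on the `2`-sites-per-direction torus: one `Params` hosts the live levels of at most
`P.m + P.K + N₁` comparison indices. [folklore] -/
theorem sitesPerDir_live_eq_two (P : Params) {σ : Type*} {S : ℕ → Finset σ} {lvl : ℕ → σ → ℕ} {N₁ : ℕ}
    {νbar : ℝ} (hw : LiveWindow S lvl N₁ νbar) {K : ℕ} (hK : P.m + P.K + N₁ ≤ K) {s : σ} (hs : s ∈ S K) :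
    P.sitesPerDir (lvl K s) = 2 :=
  sitesPerDir_eq_two_of_le P (by have := hw.recent K s hs; omega)

/-- **THE CONTRAST.**  Along a cutoff-indexed family `P : ℕ → Params` with `(P K).K = K` (Bałaban's `ε = L^{-K}`,
`Setup.Params.eps`), the level `j ≤ K` of comparison `K` keeps `2·L^{m + (K − j)}` sites per direction — never fewer
than the unit lattice's `2·L^m`. [folklore] -/
theorem sitesPerDir_scheme (P : ℕ → Params) (hP : ∀ K, (P K).K = K) {K j : ℕ} (hj : j ≤ K) :
    (P K).sitesPerDir j = 2 * (P K).L ^ ((P K).m + (K - j)) ∧ 2 * (P K).L ^ (P K).m ≤ (P K).sitesPerDir j := by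
  have h1 : (P K).sitesPerDir j = 2 * (P K).L ^ ((P K).m + (K - j)) := by
    unfold Params.sitesPerDir
    rw [hP K, Nat.add_sub_assoc hj]
  refine ⟨h1, ?_⟩
  rw [h1]
  exact Nat.mul_le_mul_left 2 (Nat.pow_le_pow_right (P K).L_pos (Nat.le_add_right _ _))

end Witness

/-! ## §1 One run: the level ledger from realized slot data on a per-slot Bałaban lattice -/

section OneRun
variable {ι σ : Type*} {G : Type*} [GaugeGroup G] [MeasurableSpace G] [HaarData G]
  {l₀ : ℝ} {T : ℕ → Finset ι} {A sh : ℕ → ℝ → ι → ℝ} {S : ℕ → Finset σ} {piece : ℕ → ℝ → σ → ι → ℝ}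
  {lvl : ℕ → σ → ℕ} {P : ℕ → σ → Params} {j : ℕ → σ → ℕ}
  {F : ∀ K : ℕ, ℝ → ∀ s : σ, GaugeField (P K s) (j K s) G → ℝ≥0∞}
  {u : ∀ K : ℕ, ℝ → ∀ s : σ, GaugeField (P K s) (j K s) G → ℝ} {θ D ρ : ℕ → ℝ} {Dslot M : ℕ → ℝ → σ → ℝ}

/-- **ONE RUN: THE LEVEL LEDGER FROM REALIZED SLOT DATA ON THE TOWER.**  Slot `s` of comparison `K` lives on the
Bałaban lattice `(P K s, j K s)` (free; e.g. `P K s = ` the cutoff-`K` parameters, `j K s = lvl K s`), its realized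
measure is `(fieldMeasure (P K s) (j K s) G).withDensity (F K t s)` and its tested variable `u K t s`; END-I's level
`lvl K s` indexes thresholds `θ`, widths `ρ`, constants `D`.  BINDERS: (R) `sh_nonneg`∕`sh_le`∕`cover`, [dict]
`hM`∕`piece_le`∕`total_ge`, signs, seam fact (i) `hFfin` (the `IsFiniteMeasure` instance is discharged inside), (M1)
per slot with SLOT constants `hac` + the displayed level majorants `hDslot` (seam fact (ii)) ⊢
`LevelLedger l₀ T A sh S piece lvl D ρ` (`ShellMeasureRootComposition.levelLedger_of_slotAC`). [folklore] -/
theorem levelLedger_of_towerData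
    (hFfin : ∀ K t s, ∫⁻ U, F K t s U ∂(fieldMeasure (P K s) (j K s) G) ≠ ∞)
    (sh_nonneg : ∀ K t, |t| ≤ l₀ → ∀ τ ∈ T K, 0 ≤ sh K t τ)
    (sh_le : ∀ K t, |t| ≤ l₀ → ∀ τ ∈ T K, sh K t τ ≤ A K t τ)
    (cover : ∀ K t, |t| ≤ l₀ → ∀ τ ∈ T K, sh K t τ ≤ ∑ s ∈ S K, piece K t s τ)
    (hM : ∀ K t, |t| ≤ l₀ → ∀ s ∈ S K, 0 ≤ M K t s)
    (piece_le : ∀ K t, |t| ≤ l₀ → ∀ s ∈ S K, ∑ τ ∈ T K, piece K t s τ ≤ M K t s *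
      (((fieldMeasure (P K s) (j K s) G).withDensity (F K t s))
        {x | θ (lvl K s) * (1 - ρ (lvl K s)) ≤ u K t s x ∧ u K t s x < θ (lvl K s)}).toReal)
    (total_ge : ∀ K t, |t| ≤ l₀ → ∀ s ∈ S K,
      M K t s * (((fieldMeasure (P K s) (j K s) G).withDensity (F K t s)) Set.univ).toReal ≤ ∑ τ ∈ T K, A K t τ)
    (hD : ∀ j, 0 ≤ D j) (hρ : ∀ j, 0 ≤ ρ j)
    (hDslot : ∀ K t, |t| ≤ l₀ → ∀ s ∈ S K, Dslot K t s ≤ D (lvl K s))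
    (hac : ∀ K t, |t| ≤ l₀ → ∀ s ∈ S K,
      SlotAntiConcentration ((fieldMeasure (P K s) (j K s) G).withDensity (F K t s)) (u K t s)
        (θ (lvl K s)) (ρ (lvl K s)) (Dslot K t s)) :
    LevelLedger l₀ T A sh S piece lvl D ρ :=
  haveI : ∀ K t s, IsFiniteMeasure ((fieldMeasure (P K s) (j K s) G).withDensity (F K t s)) :=
    fun K t s => isFiniteMeasure_withDensity (hFfin K t s)
  levelLedger_of_slotAC (μ := fun K t s => (fieldMeasure (P K s) (j K s) G).withDensity (F K t s))
    sh_nonneg sh_le cover hM piece_le total_ge hD hρ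
    (hac_of_slotConst (μ := fun K t s => (fieldMeasure (P K s) (j K s) G).withDensity (F K t s)) hρ hDslot hac)

end OneRun

/-! ## §2 END-I for two realized slot families on their towers -/

section TwoRuns
variable {ι σ σ' : Type*} {G : Type*} [GaugeGroup G] [MeasurableSpace G] [HaarData G]
  {l₀ : ℝ} {T : ℕ → Finset ι} {A B shA shB : ℕ → ℝ → ι → ℝ}
  {SA : ℕ → Finset σ} {SB : ℕ → Finset σ'} {pieceA : ℕ → ℝ → σ → ι → ℝ} {pieceB : ℕ → ℝ → σ' → ι → ℝ}
  {lvlA : ℕ → σ → ℕ} {lvlB : ℕ → σ' → ℕ}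
  {PA : ℕ → σ → Params} {jA : ℕ → σ → ℕ} {PB : ℕ → σ' → Params} {jB : ℕ → σ' → ℕ}
  {FA : ∀ K : ℕ, ℝ → ∀ s : σ, GaugeField (PA K s) (jA K s) G → ℝ≥0∞}
  {FB : ∀ K : ℕ, ℝ → ∀ s : σ', GaugeField (PB K s) (jB K s) G → ℝ≥0∞}
  {uA : ∀ K : ℕ, ℝ → ∀ s : σ, GaugeField (PA K s) (jA K s) G → ℝ}
  {uB : ∀ K : ℕ, ℝ → ∀ s : σ', GaugeField (PB K s) (jB K s) G → ℝ}
  {θA DA ρA θB DB ρB : ℕ → ℝ} {DslotA MA : ℕ → ℝ → σ → ℝ} {DslotB MB : ℕ → ℝ → σ' → ℝ}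
  {N₁ : ℕ} {νbar Dbar c₁ ϑ : ℝ} {m : ℕ → ℝ}

/-- **END-I FOR TWO REALIZED SLOT FAMILIES ON THEIR TOWERS — THE SEAM CLOSED ALONG THE CUTOFF FAMILY.**  Per run
X ∈ {A, B}: the binders of `ShellMeasureRootComposition.shellWeightBound_of_slotAC` with
`μX K t s := (fieldMeasure (PX K s) (jX K s) G).withDensity (FX K t s)` (run X's slot `s` of comparison `K` on its
own lattice), the `IsFiniteMeasure` instances DISCHARGED from `hFfinX`, the wall (M1) per slot with SLOT constants
`DslotX K t s` carried to level constants by the displayed majorants `hDslotX`; then (W1) windows + count, `D ≤ D̄`,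
rate `ρ_j ≤ c₁ϑ^j`, `0 < ϑ < 1` verbatim (node U1b BY NAME, c4).  CONCLUSION: LITERALLY END-I's
`T4IndicatorShell.ShellWeightBound l₀ T A B shA shB Wsh`, `Wsh K = Σ_{s∈S^A K} D^A_{lvl s}ρ^A_{lvl s} + Σ_{s∈S^B K}
D^B_{lvl s}ρ^B_{lvl s}`.  CONDITIONAL on every binder; nothing PRINTED is asserted. [folklore] -/
theorem shellWeightBound_of_towerData
    (hFfinA : ∀ K t s, ∫⁻ U, FA K t s U ∂(fieldMeasure (PA K s) (jA K s) G) ≠ ∞)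
    (sh_nonnegA : ∀ K t, |t| ≤ l₀ → ∀ τ ∈ T K, 0 ≤ shA K t τ)
    (sh_leA : ∀ K t, |t| ≤ l₀ → ∀ τ ∈ T K, shA K t τ ≤ A K t τ)
    (coverA : ∀ K t, |t| ≤ l₀ → ∀ τ ∈ T K, shA K t τ ≤ ∑ s ∈ SA K, pieceA K t s τ)
    (hMA : ∀ K t, |t| ≤ l₀ → ∀ s ∈ SA K, 0 ≤ MA K t s)
    (piece_leA : ∀ K t, |t| ≤ l₀ → ∀ s ∈ SA K, ∑ τ ∈ T K, pieceA K t s τ ≤ MA K t s *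
      (((fieldMeasure (PA K s) (jA K s) G).withDensity (FA K t s))
        {x | θA (lvlA K s) * (1 - ρA (lvlA K s)) ≤ uA K t s x ∧ uA K t s x < θA (lvlA K s)}).toReal)
    (total_geA : ∀ K t, |t| ≤ l₀ → ∀ s ∈ SA K,
      MA K t s * (((fieldMeasure (PA K s) (jA K s) G).withDensity (FA K t s)) Set.univ).toReal ≤ ∑ τ ∈ T K, A K t τ)
    (hDA0 : ∀ j, 0 ≤ DA j) (hρA0 : ∀ j, 0 ≤ ρA j)
    (hDslotA : ∀ K t, |t| ≤ l₀ → ∀ s ∈ SA K, DslotA K t s ≤ DA (lvlA K s))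
    (hacA : ∀ K t, |t| ≤ l₀ → ∀ s ∈ SA K,
      SlotAntiConcentration ((fieldMeasure (PA K s) (jA K s) G).withDensity (FA K t s)) (uA K t s)
        (θA (lvlA K s)) (ρA (lvlA K s)) (DslotA K t s))
    (hFfinB : ∀ K t s, ∫⁻ U, FB K t s U ∂(fieldMeasure (PB K s) (jB K s) G) ≠ ∞)
    (sh_nonnegB : ∀ K t, |t| ≤ l₀ → ∀ τ ∈ T K, 0 ≤ shB K t τ)
    (sh_leB : ∀ K t, |t| ≤ l₀ → ∀ τ ∈ T K, shB K t τ ≤ B K t τ)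
    (coverB : ∀ K t, |t| ≤ l₀ → ∀ τ ∈ T K, shB K t τ ≤ ∑ s ∈ SB K, pieceB K t s τ)
    (hMB : ∀ K t, |t| ≤ l₀ → ∀ s ∈ SB K, 0 ≤ MB K t s)
    (piece_leB : ∀ K t, |t| ≤ l₀ → ∀ s ∈ SB K, ∑ τ ∈ T K, pieceB K t s τ ≤ MB K t s *
      (((fieldMeasure (PB K s) (jB K s) G).withDensity (FB K t s))
        {x | θB (lvlB K s) * (1 - ρB (lvlB K s)) ≤ uB K t s x ∧ uB K t s x < θB (lvlB K s)}).toReal)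
    (total_geB : ∀ K t, |t| ≤ l₀ → ∀ s ∈ SB K,
      MB K t s * (((fieldMeasure (PB K s) (jB K s) G).withDensity (FB K t s)) Set.univ).toReal ≤ ∑ τ ∈ T K, B K t τ)
    (hDB0 : ∀ j, 0 ≤ DB j) (hρB0 : ∀ j, 0 ≤ ρB j)
    (hDslotB : ∀ K t, |t| ≤ l₀ → ∀ s ∈ SB K, DslotB K t s ≤ DB (lvlB K s))
    (hacB : ∀ K t, |t| ≤ l₀ → ∀ s ∈ SB K,
      SlotAntiConcentration ((fieldMeasure (PB K s) (jB K s) G).withDensity (FB K t s)) (uB K t s)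
        (θB (lvlB K s)) (ρB (lvlB K s)) (DslotB K t s))
    (hwA : LiveWindow SA lvlA N₁ νbar) (hwB : LiveWindow SB lvlB N₁ νbar) (hϑ0 : 0 < ϑ) (hϑ1 : ϑ < 1)
    (hDA : ∀ j, DA j ≤ Dbar) (hDB : ∀ j, DB j ≤ Dbar)
    (hrateA : ∀ j, ρA j ≤ c₁ * ϑ ^ j) (hrateB : ∀ j, ρB j ≤ c₁ * ϑ ^ j) :
    ShellWeightBound l₀ T A B shA shB
      (fun K => ∑ s ∈ SA K, DA (lvlA K s) * ρA (lvlA K s) + ∑ s ∈ SB K, DB (lvlB K s) * ρB (lvlB K s)) :=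
  haveI : ∀ K t s, IsFiniteMeasure ((fieldMeasure (PA K s) (jA K s) G).withDensity (FA K t s)) :=
    fun K t s => isFiniteMeasure_withDensity (hFfinA K t s)
  haveI : ∀ K t s, IsFiniteMeasure ((fieldMeasure (PB K s) (jB K s) G).withDensity (FB K t s)) :=
    fun K t s => isFiniteMeasure_withDensity (hFfinB K t s)
  shellWeightBound_of_slotAC (μA := fun K t s => (fieldMeasure (PA K s) (jA K s) G).withDensity (FA K t s))
    (μB := fun K t s => (fieldMeasure (PB K s) (jB K s) G).withDensity (FB K t s))
    sh_nonnegA sh_leA coverA hMA piece_leA total_geA hDA0 hρA0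
    (hac_of_slotConst (μ := fun K t s => (fieldMeasure (PA K s) (jA K s) G).withDensity (FA K t s))
      hρA0 hDslotA hacA)
    sh_nonnegB sh_leB coverB hMB piece_leB total_geB hDB0 hρB0
    (hac_of_slotConst (μ := fun K t s => (fieldMeasure (PB K s) (jB K s) G).withDensity (FB K t s))
      hρB0 hDslotB hacB)
    hwA hwB hϑ0 hϑ1 hDA hDB hrateA hrateB

/-- **… BAND TWIN (road P2's head, trigger c6).**  The same with `Summable ρ^A`, `Summable ρ^B` and age-resolved slot
counts in place of the geometric rate (`ShellMeasureRootComposition.shellWeightBound_of_slotAC_band`). [folklore] -/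
theorem shellWeightBound_of_towerData_band
    (hFfinA : ∀ K t s, ∫⁻ U, FA K t s U ∂(fieldMeasure (PA K s) (jA K s) G) ≠ ∞)
    (sh_nonnegA : ∀ K t, |t| ≤ l₀ → ∀ τ ∈ T K, 0 ≤ shA K t τ)
    (sh_leA : ∀ K t, |t| ≤ l₀ → ∀ τ ∈ T K, shA K t τ ≤ A K t τ)
    (coverA : ∀ K t, |t| ≤ l₀ → ∀ τ ∈ T K, shA K t τ ≤ ∑ s ∈ SA K, pieceA K t s τ)
    (hMA : ∀ K t, |t| ≤ l₀ → ∀ s ∈ SA K, 0 ≤ MA K t s)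
    (piece_leA : ∀ K t, |t| ≤ l₀ → ∀ s ∈ SA K, ∑ τ ∈ T K, pieceA K t s τ ≤ MA K t s *
      (((fieldMeasure (PA K s) (jA K s) G).withDensity (FA K t s))
        {x | θA (lvlA K s) * (1 - ρA (lvlA K s)) ≤ uA K t s x ∧ uA K t s x < θA (lvlA K s)}).toReal)
    (total_geA : ∀ K t, |t| ≤ l₀ → ∀ s ∈ SA K,
      MA K t s * (((fieldMeasure (PA K s) (jA K s) G).withDensity (FA K t s)) Set.univ).toReal ≤ ∑ τ ∈ T K, A K t τ)
    (hDA0 : ∀ j, 0 ≤ DA j) (hρA0 : ∀ j, 0 ≤ ρA j)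
    (hDslotA : ∀ K t, |t| ≤ l₀ → ∀ s ∈ SA K, DslotA K t s ≤ DA (lvlA K s))
    (hacA : ∀ K t, |t| ≤ l₀ → ∀ s ∈ SA K,
      SlotAntiConcentration ((fieldMeasure (PA K s) (jA K s) G).withDensity (FA K t s)) (uA K t s)
        (θA (lvlA K s)) (ρA (lvlA K s)) (DslotA K t s))
    (hFfinB : ∀ K t s, ∫⁻ U, FB K t s U ∂(fieldMeasure (PB K s) (jB K s) G) ≠ ∞)
    (sh_nonnegB : ∀ K t, |t| ≤ l₀ → ∀ τ ∈ T K, 0 ≤ shB K t τ)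
    (sh_leB : ∀ K t, |t| ≤ l₀ → ∀ τ ∈ T K, shB K t τ ≤ B K t τ)
    (coverB : ∀ K t, |t| ≤ l₀ → ∀ τ ∈ T K, shB K t τ ≤ ∑ s ∈ SB K, pieceB K t s τ)
    (hMB : ∀ K t, |t| ≤ l₀ → ∀ s ∈ SB K, 0 ≤ MB K t s)
    (piece_leB : ∀ K t, |t| ≤ l₀ → ∀ s ∈ SB K, ∑ τ ∈ T K, pieceB K t s τ ≤ MB K t s *
      (((fieldMeasure (PB K s) (jB K s) G).withDensity (FB K t s))
        {x | θB (lvlB K s) * (1 - ρB (lvlB K s)) ≤ uB K t s x ∧ uB K t s x < θB (lvlB K s)}).toReal)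
    (total_geB : ∀ K t, |t| ≤ l₀ → ∀ s ∈ SB K,
      MB K t s * (((fieldMeasure (PB K s) (jB K s) G).withDensity (FB K t s)) Set.univ).toReal ≤ ∑ τ ∈ T K, B K t τ)
    (hDB0 : ∀ j, 0 ≤ DB j) (hρB0 : ∀ j, 0 ≤ ρB j)
    (hDslotB : ∀ K t, |t| ≤ l₀ → ∀ s ∈ SB K, DslotB K t s ≤ DB (lvlB K s))
    (hacB : ∀ K t, |t| ≤ l₀ → ∀ s ∈ SB K,
      SlotAntiConcentration ((fieldMeasure (PB K s) (jB K s) G).withDensity (FB K t s)) (uB K t s)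
        (θB (lvlB K s)) (ρB (lvlB K s)) (DslotB K t s))
    (hwA : LiveWindow SA lvlA N₁ νbar) (hwB : LiveWindow SB lvlB N₁ νbar)
    (hDA : ∀ j, DA j ≤ Dbar) (hDB : ∀ j, DB j ≤ Dbar)
    (hmA : ∀ K, ∀ a ≤ N₁, (((SA K).filter fun s => K - lvlA K s = a).card : ℝ) ≤ m a)
    (hmB : ∀ K, ∀ a ≤ N₁, (((SB K).filter fun s => K - lvlB K s = a).card : ℝ) ≤ m a)
    (hρA : Summable ρA) (hρB : Summable ρB) :
    ShellWeightBound l₀ T A B shA shB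
      (fun K => ∑ s ∈ SA K, DA (lvlA K s) * ρA (lvlA K s) + ∑ s ∈ SB K, DB (lvlB K s) * ρB (lvlB K s)) :=
  haveI : ∀ K t s, IsFiniteMeasure ((fieldMeasure (PA K s) (jA K s) G).withDensity (FA K t s)) :=
    fun K t s => isFiniteMeasure_withDensity (hFfinA K t s)
  haveI : ∀ K t s, IsFiniteMeasure ((fieldMeasure (PB K s) (jB K s) G).withDensity (FB K t s)) :=
    fun K t s => isFiniteMeasure_withDensity (hFfinB K t s)
  shellWeightBound_of_slotAC_band (μA := fun K t s => (fieldMeasure (PA K s) (jA K s) G).withDensity (FA K t s))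
    (μB := fun K t s => (fieldMeasure (PB K s) (jB K s) G).withDensity (FB K t s))
    sh_nonnegA sh_leA coverA hMA piece_leA total_geA hDA0 hρA0
    (hac_of_slotConst (μ := fun K t s => (fieldMeasure (PA K s) (jA K s) G).withDensity (FA K t s))
      hρA0 hDslotA hacA)
    sh_nonnegB sh_leB coverB hMB piece_leB total_geB hDB0 hρB0
    (hac_of_slotConst (μ := fun K t s => (fieldMeasure (PB K s) (jB K s) G).withDensity (FB K t s))
      hρB0 hDslotB hacB)
    hwA hwB hDA hDB hmA hmB hρA hρB

/-- **… THROUGH THE SEAM (ζ′) SOCKET.**  The binders of `shellWeightBound_of_towerData` PLUS the NE7b half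
`RelWeightBound`, a `ReindexedBudget` on the hybrid cores and four summable producer rates ⇒ `∃ K₀`,
`T4MatchingAssembly.HybridNE7` for the shifted families (`ShellMeasureRootComposition.hybridNE7_tail_of_slotAC`).
[folklore] -/
theorem hybridNE7_tail_of_towerData [DecidableEq ι] {vol : ℝ} {Bad : ℕ → ℝ → Finset ι}
    {Cc Rr CcRec RrRec : ℕ → ℝ → ι → ℝ} {ν u' s₂ c₀ r s' W : ℕ → ℝ}
    (hFfinA : ∀ K t s, ∫⁻ U, FA K t s U ∂(fieldMeasure (PA K s) (jA K s) G) ≠ ∞)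
    (sh_nonnegA : ∀ K t, |t| ≤ l₀ → ∀ τ ∈ T K, 0 ≤ shA K t τ)
    (sh_leA : ∀ K t, |t| ≤ l₀ → ∀ τ ∈ T K, shA K t τ ≤ A K t τ)
    (coverA : ∀ K t, |t| ≤ l₀ → ∀ τ ∈ T K, shA K t τ ≤ ∑ s ∈ SA K, pieceA K t s τ)
    (hMA : ∀ K t, |t| ≤ l₀ → ∀ s ∈ SA K, 0 ≤ MA K t s)
    (piece_leA : ∀ K t, |t| ≤ l₀ → ∀ s ∈ SA K, ∑ τ ∈ T K, pieceA K t s τ ≤ MA K t s *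
      (((fieldMeasure (PA K s) (jA K s) G).withDensity (FA K t s))
        {x | θA (lvlA K s) * (1 - ρA (lvlA K s)) ≤ uA K t s x ∧ uA K t s x < θA (lvlA K s)}).toReal)
    (total_geA : ∀ K t, |t| ≤ l₀ → ∀ s ∈ SA K,
      MA K t s * (((fieldMeasure (PA K s) (jA K s) G).withDensity (FA K t s)) Set.univ).toReal ≤ ∑ τ ∈ T K, A K t τ)
    (hDA0 : ∀ j, 0 ≤ DA j) (hρA0 : ∀ j, 0 ≤ ρA j)
    (hDslotA : ∀ K t, |t| ≤ l₀ → ∀ s ∈ SA K, DslotA K t s ≤ DA (lvlA K s))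
    (hacA : ∀ K t, |t| ≤ l₀ → ∀ s ∈ SA K,
      SlotAntiConcentration ((fieldMeasure (PA K s) (jA K s) G).withDensity (FA K t s)) (uA K t s)
        (θA (lvlA K s)) (ρA (lvlA K s)) (DslotA K t s))
    (hFfinB : ∀ K t s, ∫⁻ U, FB K t s U ∂(fieldMeasure (PB K s) (jB K s) G) ≠ ∞)
    (sh_nonnegB : ∀ K t, |t| ≤ l₀ → ∀ τ ∈ T K, 0 ≤ shB K t τ)
    (sh_leB : ∀ K t, |t| ≤ l₀ → ∀ τ ∈ T K, shB K t τ ≤ B K t τ)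
    (coverB : ∀ K t, |t| ≤ l₀ → ∀ τ ∈ T K, shB K t τ ≤ ∑ s ∈ SB K, pieceB K t s τ)
    (hMB : ∀ K t, |t| ≤ l₀ → ∀ s ∈ SB K, 0 ≤ MB K t s)
    (piece_leB : ∀ K t, |t| ≤ l₀ → ∀ s ∈ SB K, ∑ τ ∈ T K, pieceB K t s τ ≤ MB K t s *
      (((fieldMeasure (PB K s) (jB K s) G).withDensity (FB K t s))
        {x | θB (lvlB K s) * (1 - ρB (lvlB K s)) ≤ uB K t s x ∧ uB K t s x < θB (lvlB K s)}).toReal)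
    (total_geB : ∀ K t, |t| ≤ l₀ → ∀ s ∈ SB K,
      MB K t s * (((fieldMeasure (PB K s) (jB K s) G).withDensity (FB K t s)) Set.univ).toReal ≤ ∑ τ ∈ T K, B K t τ)
    (hDB0 : ∀ j, 0 ≤ DB j) (hρB0 : ∀ j, 0 ≤ ρB j)
    (hDslotB : ∀ K t, |t| ≤ l₀ → ∀ s ∈ SB K, DslotB K t s ≤ DB (lvlB K s))
    (hacB : ∀ K t, |t| ≤ l₀ → ∀ s ∈ SB K,
      SlotAntiConcentration ((fieldMeasure (PB K s) (jB K s) G).withDensity (FB K t s)) (uB K t s)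
        (θB (lvlB K s)) (ρB (lvlB K s)) (DslotB K t s))
    (hwA : LiveWindow SA lvlA N₁ νbar) (hwB : LiveWindow SB lvlB N₁ νbar) (hϑ0 : 0 < ϑ) (hϑ1 : ϑ < 1)
    (hDA : ∀ j, DA j ≤ Dbar) (hDB : ∀ j, DB j ≤ Dbar)
    (hrateA : ∀ j, ρA j ≤ c₁ * ϑ ^ j) (hrateB : ∀ j, ρB j ≤ c₁ * ϑ ^ j)
    (hW : RelWeightBound l₀ T A B Bad W)
    (hTB : ReindexedBudget l₀ vol T (fun K t τ => A K t τ - shA K t τ) (fun K t τ => B K t τ - shB K t τ) Bad Cc Rr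
      CcRec RrRec ν u' s₂ c₀ r s')
    (hr : Summable r) (hu : Summable u') (hs : Summable s') (hs₂ : Summable s₂) :
    ∃ K₀, HybridNE7 l₀ vol (fun K => T (K₀ + K)) (fun K => A (K₀ + K)) (fun K => B (K₀ + K)) (fun K => Bad (K₀ + K))
      (fun K => W (K₀ + K)) (fun K => shA (K₀ + K)) (fun K => shB (K₀ + K))
      (fun K => ∑ s ∈ SA (K₀ + K), DA (lvlA (K₀ + K) s) * ρA (lvlA (K₀ + K) s) +
        ∑ s ∈ SB (K₀ + K), DB (lvlB (K₀ + K) s) * ρB (lvlB (K₀ + K) s))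
      (fun K => (r (K₀ + K) + u' (K₀ + K)) + (s' (K₀ + K) + s₂ (K₀ + K))) :=
  haveI : ∀ K t s, IsFiniteMeasure ((fieldMeasure (PA K s) (jA K s) G).withDensity (FA K t s)) :=
    fun K t s => isFiniteMeasure_withDensity (hFfinA K t s)
  haveI : ∀ K t s, IsFiniteMeasure ((fieldMeasure (PB K s) (jB K s) G).withDensity (FB K t s)) :=
    fun K t s => isFiniteMeasure_withDensity (hFfinB K t s)
  hybridNE7_tail_of_slotAC (μA := fun K t s => (fieldMeasure (PA K s) (jA K s) G).withDensity (FA K t s))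
    (μB := fun K t s => (fieldMeasure (PB K s) (jB K s) G).withDensity (FB K t s))
    sh_nonnegA sh_leA coverA hMA piece_leA total_geA hDA0 hρA0
    (hac_of_slotConst (μ := fun K t s => (fieldMeasure (PA K s) (jA K s) G).withDensity (FA K t s))
      hρA0 hDslotA hacA)
    sh_nonnegB sh_leB coverB hMB piece_leB total_geB hDB0 hρB0
    (hac_of_slotConst (μ := fun K t s => (fieldMeasure (PB K s) (jB K s) G).withDensity (FB K t s))
      hρB0 hDslotB hacB)
    hwA hwB hϑ0 hϑ1 hDA hDB hrateA hrateB hW hTB hr hu hs hs₂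

end TwoRuns

/-! ## §3 One reading along a cutoff scheme (node U1b's convention) -/

section Special
variable {ι σ σ' : Type*} {l₀ : ℝ} {T : ℕ → Finset ι} {G : Type*} [GaugeGroup G] [MeasurableSpace G] [HaarData G]
  {A B shA shB : ℕ → ℝ → ι → ℝ} {SA : ℕ → Finset σ} {SB : ℕ → Finset σ'}
  {pieceA : ℕ → ℝ → σ → ι → ℝ} {pieceB : ℕ → ℝ → σ' → ι → ℝ} {lvlA : ℕ → σ → ℕ} {lvlB : ℕ → σ' → ℕ}
  {Psch : ℕ → Params}
  {FA : ∀ K : ℕ, ℝ → ∀ s : σ, GaugeField (Psch K) (lvlA K s) G → ℝ≥0∞}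
  {FB : ∀ K : ℕ, ℝ → ∀ s : σ', GaugeField (Psch (K + 1)) (lvlB K s + 1) G → ℝ≥0∞}
  {uA : ∀ K : ℕ, ℝ → ∀ s : σ, GaugeField (Psch K) (lvlA K s) G → ℝ}
  {uB : ∀ K : ℕ, ℝ → ∀ s : σ', GaugeField (Psch (K + 1)) (lvlB K s + 1) G → ℝ}
  {θA DA ρA θB DB ρB : ℕ → ℝ} {DslotA MA : ℕ → ℝ → σ → ℝ} {DslotB MB : ℕ → ℝ → σ' → ℝ}
  {N₁ : ℕ} {νbar Dbar c₁ ϑ : ℝ}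

/-- **ONE READING ALONG A CUTOFF SCHEME `Psch : ℕ → Params`** (node U1b's `T4SupCloseLiaison.ReadsLevels` convention,
typed as a SPECIAL CASE of `shellWeightBound_of_towerData` — offered to the [dict] seat, NOT a definition of the
unconstructed NODE O): at comparison `K`, run A is the `K`-step run on `Psch K` and its slot of level `j = lvlA K s`
lives on `(Psch K, j)`; run B is the `(K+1)`-step run on `Psch (K+1)` and its slot of level `j = lvlB K s` (born one
step later) lives on `(Psch (K+1), j+1)`.  Binders and conclusion otherwise verbatim END-I's. [folklore] -/
theorem shellWeightBound_of_schemeData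
    (hFfinA : ∀ K t s, ∫⁻ U, FA K t s U ∂(fieldMeasure (Psch K) (lvlA K s) G) ≠ ∞)
    (sh_nonnegA : ∀ K t, |t| ≤ l₀ → ∀ τ ∈ T K, 0 ≤ shA K t τ)
    (sh_leA : ∀ K t, |t| ≤ l₀ → ∀ τ ∈ T K, shA K t τ ≤ A K t τ)
    (coverA : ∀ K t, |t| ≤ l₀ → ∀ τ ∈ T K, shA K t τ ≤ ∑ s ∈ SA K, pieceA K t s τ)
    (hMA : ∀ K t, |t| ≤ l₀ → ∀ s ∈ SA K, 0 ≤ MA K t s)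
    (piece_leA : ∀ K t, |t| ≤ l₀ → ∀ s ∈ SA K, ∑ τ ∈ T K, pieceA K t s τ ≤ MA K t s *
      (((fieldMeasure (Psch K) (lvlA K s) G).withDensity (FA K t s))
        {x | θA (lvlA K s) * (1 - ρA (lvlA K s)) ≤ uA K t s x ∧ uA K t s x < θA (lvlA K s)}).toReal)
    (total_geA : ∀ K t, |t| ≤ l₀ → ∀ s ∈ SA K,
      MA K t s * (((fieldMeasure (Psch K) (lvlA K s) G).withDensity (FA K t s)) Set.univ).toReal ≤ ∑ τ ∈ T K, A K t τ)
    (hDA0 : ∀ j, 0 ≤ DA j) (hρA0 : ∀ j, 0 ≤ ρA j)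
    (hDslotA : ∀ K t, |t| ≤ l₀ → ∀ s ∈ SA K, DslotA K t s ≤ DA (lvlA K s))
    (hacA : ∀ K t, |t| ≤ l₀ → ∀ s ∈ SA K,
      SlotAntiConcentration ((fieldMeasure (Psch K) (lvlA K s) G).withDensity (FA K t s)) (uA K t s)
        (θA (lvlA K s)) (ρA (lvlA K s)) (DslotA K t s))
    (hFfinB : ∀ K t s, ∫⁻ U, FB K t s U ∂(fieldMeasure (Psch (K + 1)) (lvlB K s + 1) G) ≠ ∞)
    (sh_nonnegB : ∀ K t, |t| ≤ l₀ → ∀ τ ∈ T K, 0 ≤ shB K t τ)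
    (sh_leB : ∀ K t, |t| ≤ l₀ → ∀ τ ∈ T K, shB K t τ ≤ B K t τ)
    (coverB : ∀ K t, |t| ≤ l₀ → ∀ τ ∈ T K, shB K t τ ≤ ∑ s ∈ SB K, pieceB K t s τ)
    (hMB : ∀ K t, |t| ≤ l₀ → ∀ s ∈ SB K, 0 ≤ MB K t s)
    (piece_leB : ∀ K t, |t| ≤ l₀ → ∀ s ∈ SB K, ∑ τ ∈ T K, pieceB K t s τ ≤ MB K t s *
      (((fieldMeasure (Psch (K + 1)) (lvlB K s + 1) G).withDensity (FB K t s))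
        {x | θB (lvlB K s) * (1 - ρB (lvlB K s)) ≤ uB K t s x ∧ uB K t s x < θB (lvlB K s)}).toReal)
    (total_geB : ∀ K t, |t| ≤ l₀ → ∀ s ∈ SB K,
      MB K t s * (((fieldMeasure (Psch (K + 1)) (lvlB K s + 1) G).withDensity (FB K t s)) Set.univ).toReal ≤
        ∑ τ ∈ T K, B K t τ)
    (hDB0 : ∀ j, 0 ≤ DB j) (hρB0 : ∀ j, 0 ≤ ρB j)
    (hDslotB : ∀ K t, |t| ≤ l₀ → ∀ s ∈ SB K, DslotB K t s ≤ DB (lvlB K s))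
    (hacB : ∀ K t, |t| ≤ l₀ → ∀ s ∈ SB K,
      SlotAntiConcentration ((fieldMeasure (Psch (K + 1)) (lvlB K s + 1) G).withDensity (FB K t s)) (uB K t s)
        (θB (lvlB K s)) (ρB (lvlB K s)) (DslotB K t s))
    (hwA : LiveWindow SA lvlA N₁ νbar) (hwB : LiveWindow SB lvlB N₁ νbar) (hϑ0 : 0 < ϑ) (hϑ1 : ϑ < 1)
    (hDA : ∀ j, DA j ≤ Dbar) (hDB : ∀ j, DB j ≤ Dbar)
    (hrateA : ∀ j, ρA j ≤ c₁ * ϑ ^ j) (hrateB : ∀ j, ρB j ≤ c₁ * ϑ ^ j) :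
    ShellWeightBound l₀ T A B shA shB
      (fun K => ∑ s ∈ SA K, DA (lvlA K s) * ρA (lvlA K s) + ∑ s ∈ SB K, DB (lvlB K s) * ρB (lvlB K s)) :=
  shellWeightBound_of_towerData (PA := fun K _ => Psch K) (jA := lvlA) (PB := fun K _ => Psch (K + 1))
    (jB := fun K s => lvlB K s + 1)
    hFfinA sh_nonnegA sh_leA coverA hMA piece_leA total_geA hDA0 hρA0 hDslotA hacA
    hFfinB sh_nonnegB sh_leB coverB hMB piece_leB total_geB hDB0 hρB0 hDslotB hacB
    hwA hwB hϑ0 hϑ1 hDA hDB hrateA hrateB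

end Special

end Summit.QuantumFields.BalabanUV.T4Continuum.ShellMeasureRootCompositionSeamTower
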